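import Summits.KontsevichZagierPeriods.KontsevichZagierPeriods.Theorems.SymplecticScissorsRealOnePeriodRelationsQuarticLayer
import Summits.KontsevichZagierPeriods.KontsevichZagierPeriods.Theorems.SymplecticScissorsRealOnePeriodRelationsStubBiellSquareCell
import Summits.KontsevichZagierPeriods.KontsevichZagierPeriods.Theorems.SymplecticScissorsRealOnePeriodRelationsStubCubicOvalReciprocalCell
import Summits.KontsevichZagierPeriods.KontsevichZagierPeriods.Theorems.SymplecticScissorsRealOnePeriodRelationsStubHomotopyInvarianceAux

/-!
# `RealOnePeriodRelations` (stmt-KontsevichZagierPeriods-10042), line `nash-retraction-thin-strip`, reshape 8b: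
# the BIELLIPTIC GENUS-2 OVAL layer of the crux, unconditionally — the first genus-2 periods in the layer tower

A complete real period `∫_a^b (c₀ + c₁x) dx/√S(x)` of a bielliptic genus-2 curve `y² = S(x) = P(x²)` (`P` a separable real algebraic
cubic with `P(0) ≠ 0`; both holomorphic differentials `dx/y`, `x dx/y`) over a real oval `(a, b)`, `0 < a < b`, with simple end
roots is carried by Kontsevich–Zagier's rules onto complete ELLIPTIC integrals: the squaring move `u = x²` (rule 2) followed by
rule (1b) (`stub_biellSquareCell`, p-landed) gives oval integrals of the quartic `u·P(u)` and of the cubic `P`, and the reciprocal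
move `u = 1/v` (`stub_cubicOvalReciprocalCell`, p150650) turns the latter into an oval integral of the quartic `v·P*(v)`.  The landed
quartic-oval layer `QuarticLayer.realOnePeriodRelations_ratQuarticOvalLayer` (p142611: Möbius onto resolvent cubics, uniformization,
and Huber–Wüstholz 13.3 (2) for closed paths on any finite family of elliptic curves over `ℚ̄` — CM and isogenies allowed — with
Baker for the rational representations) then applies to the `2n` quartics:

* `realOnePeriodRelations_ratBiellipticOvalLayer` — every `ℤ`-combination with vanishing value of rational representations,
  polynomial cells and complete bielliptic genus-2 oval periods lies in `M₁ = closure (1a ∪ 1b ∪ 2 ∪ Green)` — unconditionally.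

References: A. Huber, G. Wüstholz, *Transcendence and Linear Relations of 1-Periods* (CUP 2022), Thm 13.3 (2), Thm 15.3 (1);
M. Kontsevich, D. Zagier, *Periods* (2001), §1.2 (rules 1b, 2).
-/

noncomputable section

open scoped BigOperators Polynomial
open Set MeasureTheory
open Literature.NumberTheory.Transcendental
open Summit.KontsevichZagierPeriods.SymplecticScissors.RealOnePeriodRelationsNegative (M₁ H₁)

namespace Summit.KontsevichZagierPeriods.SymplecticScissors.RealOnePeriodRelations

namespace BiellipticLayer

/-- `closure (1a ∪ 1b ∪ 2) ≤ M₁`. [cite: KontsevichZagier2001, §1.2] -/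
theorem closure_rules_le_M₁ :
    AddSubgroup.closure (KZ.domainAddRel ∪ KZ.integrandAddRel ∪ KZ.changeOfVariablesRel) ≤ M₁ :=
  AddSubgroup.closure_mono Set.subset_union_left

-- Rule (2) instances lie in `M₁`: `HomotopyInvariance.changeOfVariablesRel_subset` (landed, imported).

/-- Separability of `u·P(u)` from that of `P` with `P(0) ≠ 0` (complex roots). [folklore] -/
theorem sep_mulX (p₃ p₂ p₁ p₀ : ℂ) (hp₀ : p₀ ≠ 0)
    (hsep : ∀ x : ℂ, p₃ * x ^ 3 + p₂ * x ^ 2 + p₁ * x + p₀ = 0 → 3 * p₃ * x ^ 2 + 2 * p₂ * x + p₁ ≠ 0) :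
    ∀ x : ℂ, p₃ * x ^ 4 + p₂ * x ^ 3 + p₁ * x ^ 2 + p₀ * x + 0 = 0 → 4 * p₃ * x ^ 3 + 3 * p₂ * x ^ 2 + 2 * p₁ * x + p₀ ≠ 0 := by
  intro x hx hd
  have hfac : x * (p₃ * x ^ 3 + p₂ * x ^ 2 + p₁ * x + p₀) = 0 := by linear_combination hx
  rcases mul_eq_zero.mp hfac with hx0 | hP
  · subst hx0
    apply hp₀
    linear_combination hd
  · have hx0 : x ≠ 0 := by
      rintro rfl
      apply hp₀
      linear_combination hP
    have hP' := hsep x hP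
    apply hP'
    have : x * (3 * p₃ * x ^ 2 + 2 * p₂ * x + p₁) = 0 := by linear_combination hd - hP
    exact (mul_eq_zero.mp this).resolve_left hx0

/-- Separability of the reversed quartic `v·P*(v)` (`P*(v) = v³P(1/v)`) from that of `P` with `P(0) ≠ 0`, `p₃ ≠ 0`. [folklore] -/
theorem sep_reverse (p₃ p₂ p₁ p₀ : ℂ) (hp₃ : p₃ ≠ 0)
    (hsep : ∀ x : ℂ, p₃ * x ^ 3 + p₂ * x ^ 2 + p₁ * x + p₀ = 0 → 3 * p₃ * x ^ 2 + 2 * p₂ * x + p₁ ≠ 0) :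
    ∀ x : ℂ, p₀ * x ^ 4 + p₁ * x ^ 3 + p₂ * x ^ 2 + p₃ * x + 0 = 0 → 4 * p₀ * x ^ 3 + 3 * p₁ * x ^ 2 + 2 * p₂ * x + p₃ ≠ 0 := by
  intro x hx hd
  by_cases hx0 : x = 0
  · subst hx0
    apply hp₃
    linear_combination hd
  · -- `P(1/x) = 0` and `P′(1/x) = 0`
    have hP : p₃ * x⁻¹ ^ 3 + p₂ * x⁻¹ ^ 2 + p₁ * x⁻¹ + p₀ = 0 := by
      have e : p₃ * x⁻¹ ^ 3 + p₂ * x⁻¹ ^ 2 + p₁ * x⁻¹ + p₀ = x⁻¹ ^ 4 * (p₀ * x ^ 4 + p₁ * x ^ 3 + p₂ * x ^ 2 + p₃ * x + 0) := by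
        field_simp
        ring
      rw [e, hx, mul_zero]
    have hP' : 3 * p₃ * x⁻¹ ^ 2 + 2 * p₂ * x⁻¹ + p₁ = 0 := by
      have e : 3 * p₃ * x⁻¹ ^ 2 + 2 * p₂ * x⁻¹ + p₁ =
          x⁻¹ ^ 3 * (4 * (p₀ * x ^ 4 + p₁ * x ^ 3 + p₂ * x ^ 2 + p₃ * x + 0) -
            x * (4 * p₀ * x ^ 3 + 3 * p₁ * x ^ 2 + 2 * p₂ * x + p₃)) := by
        field_simp
        ring
      rw [e, hx, hd, mul_zero, mul_zero, sub_zero, mul_zero]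
    exact hsep _ hP hP'

/-- Pointwise algebraicity of an appended family. [folklore] -/
theorem isAlgebraic_append {n m : ℕ} {f : Fin n → ℝ} {g : Fin m → ℝ} (hf : ∀ j, IsAlgebraic ℚ (f j))
    (hg : ∀ j, IsAlgebraic ℚ (g j)) : ∀ k, IsAlgebraic ℚ (Fin.append f g k) := by
  intro k
  refine Fin.addCases (fun j => ?_) (fun j => ?_) k
  · rw [Fin.append_left]; exact hf j
  · rw [Fin.append_right]; exact hg j

/-- **THE BIELLIPTIC GENUS-2 OVAL LAYER OF THE CRUX, UNCONDITIONALLY, WITH THE RATIONAL REPRESENTATIONS.**  Let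
`S_j(x) = P_j(x²)`, `P_j(u) = p₃u³ + p₂u² + p₁u + p₀` over `ℚ̄ ∩ ℝ` with `p₃ ≠ 0`, `P_j(0) ≠ 0` and `P_j` separable (so the sextic
`S_j` is separable: a genus-2 bielliptic curve `y² = S_j(x)`), and let `(a_j, b_j)`, `0 < a_j < b_j`, be a real oval of `S_j`
(`S_j(a_j) = S_j(b_j) = 0`, `S_j > 0` inside) with `P_j′(a_j²) > 0 > P_j′(b_j²)`.  Every `ℤ`-combination with vanishing value of
rational representations, polynomial cells and COMPLETE genus-2 integrals `∫_{a_j}^{b_j} (c₀ + c₁x) dx/√S_j(x)` (`c₀, c₁` real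
algebraic — both holomorphic differentials `dx/y`, `x dx/y` of the curve) lies in `M₁ = closure (1a ∪ 1b ∪ 2 ∪ Green)`.  Proof: the
squaring move `u = x²` (`stub_biellSquareCell`: rule 2 then rule 1b) splits each oval integral into complete elliptic oval integrals
of the quartic `u·P_j(u)` and of the cubic `P_j`, the latter becoming a quartic oval of `v·P_j*(v)` under `u = 1/v`
(`stub_cubicOvalReciprocalCell`), and the landed `QuarticLayer.realOnePeriodRelations_ratQuarticOvalLayer` (Huber–Wüstholz 13.3 (2)
for closed paths on any finite family of elliptic curves over `ℚ̄`, CM and isogenies allowed, with Baker for the rational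
representations) applies to the `2n` quartics.  The first genus-2 periods in the layer tower of the crux.
[cite: HuberWustholz2022, Thm 13.3 (2), Thm 15.3 (1)] [cite: KontsevichZagier2001, §1.2 (rules 1b, 2)] -/
theorem realOnePeriodRelations_ratBiellipticOvalLayer : ∀ (n : ℕ) (p₃ p₂ p₁ p₀ a b : Fin n → ℝ),
    (∀ j, IsAlgebraic ℚ (p₃ j)) → (∀ j, IsAlgebraic ℚ (p₂ j)) → (∀ j, IsAlgebraic ℚ (p₁ j)) → (∀ j, IsAlgebraic ℚ (p₀ j)) →
    (∀ j, IsAlgebraic ℚ (a j)) → (∀ j, IsAlgebraic ℚ (b j)) → (∀ j, p₃ j ≠ 0) → (∀ j, p₀ j ≠ 0) →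
    (∀ j, ∀ x : ℂ, (p₃ j : ℂ) * x ^ 3 + p₂ j * x ^ 2 + p₁ j * x + p₀ j = 0 → 3 * (p₃ j : ℂ) * x ^ 2 + 2 * p₂ j * x + p₁ j ≠ 0) →
    (∀ j, 0 < a j) → (∀ j, a j < b j) →
    (∀ j, p₃ j * a j ^ 6 + p₂ j * a j ^ 4 + p₁ j * a j ^ 2 + p₀ j = 0) →
    (∀ j, p₃ j * b j ^ 6 + p₂ j * b j ^ 4 + p₁ j * b j ^ 2 + p₀ j = 0) →
    (∀ j, ∀ x ∈ Set.Ioo (a j) (b j), 0 < p₃ j * x ^ 6 + p₂ j * x ^ 4 + p₁ j * x ^ 2 + p₀ j) →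
    (∀ j, 0 < 3 * p₃ j * a j ^ 4 + 2 * p₂ j * a j ^ 2 + p₁ j) → (∀ j, 3 * p₃ j * b j ^ 4 + 2 * p₂ j * b j ^ 2 + p₁ j < 0) →
    ∀ c : KZ.FormalRep, c ∈ AddSubgroup.closure ((fun r : KZ.IntegralRep 1 => KZ.of r) ''
      {r | r.IsRational ∨ (∃ a' b' : ℝ, IsAlgebraic ℚ a' ∧ IsAlgebraic ℚ b' ∧ a' < b' ∧ r.domain = {z | z 0 ∈ Set.Ioo a' b'} ∧
            ∃ P : Polynomial (algebraicClosure ℚ ℝ), ∀ x ∈ Set.Ioo a' b', r.integrand (fun _ => x) = Polynomial.aeval x P) ∨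
        (∃ j, ∃ c₀ c₁ : ℝ, IsAlgebraic ℚ c₀ ∧ IsAlgebraic ℚ c₁ ∧ r.domain = {z | z 0 ∈ Set.Ioo (a j) (b j)} ∧
          ∀ z ∈ r.domain, r.integrand z =
            (c₀ + c₁ * z 0) / Real.sqrt (p₃ j * (z 0) ^ 6 + p₂ j * (z 0) ^ 4 + p₁ j * (z 0) ^ 2 + p₀ j))}) →
    KZ.eval c = 0 →
    c ∈ AddSubgroup.closure (KZ.domainAddRel ∪ KZ.integrandAddRel ∪ KZ.changeOfVariablesRel ∪
      {g : KZ.FormalRep | ∃ (Δ : Set (Fin 2 → ℝ)) (A B S : (Fin 2 → ℝ) → ℝ) (r₀₁ r₁₂ r₀₂ : KZ.IntegralRep 1),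
        Δ = {p | 0 ≤ p 0 ∧ 0 ≤ p 1 ∧ p 0 + p 1 ≤ 1} ∧ IsSemialgebraicFunOn ℚ Δ A ∧ IsSemialgebraicFunOn ℚ Δ B ∧
        ContinuousOn A Δ ∧ ContinuousOn B Δ ∧
        (∀ p : Fin 2 → ℝ, 0 < p 0 → 0 < p 1 → p 0 + p 1 < 1 →
          HasFDerivAt S (A p • ContinuousLinearMap.proj (R := ℝ) (φ := fun _ : Fin 2 => ℝ) 0 +
            B p • ContinuousLinearMap.proj (R := ℝ) (φ := fun _ : Fin 2 => ℝ) 1) p) ∧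
        r₀₁.domain = {z | z 0 ∈ Set.Ioo 0 1} ∧ r₁₂.domain = {z | z 0 ∈ Set.Ioo 0 1} ∧
        r₀₂.domain = {z | z 0 ∈ Set.Ioo 0 1} ∧ (∀ z ∈ r₀₁.domain, r₀₁.integrand z = A ![z 0, 0]) ∧
        (∀ z ∈ r₁₂.domain, r₁₂.integrand z = B ![1 - z 0, z 0] - A ![1 - z 0, z 0]) ∧
        (∀ z ∈ r₀₂.domain, r₀₂.integrand z = B ![0, z 0]) ∧ g = KZ.of r₀₁ + KZ.of r₁₂ - KZ.of r₀₂}) := by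
  intro n p₃ p₂ p₁ p₀ a b hp₃ hp₂ hp₁ hp₀ ha hb hp₃0 hp₀0 hsep h0a hab hSa hSb hpos hPa hPb c hc heval
  change c ∈ M₁
  -- the `2n` quartics `u·P_j(u)` (marked at `a_j²`) and `v·P_j*(v)` (marked at `1/b_j²`)
  set A₄ : Fin (n + n) → ℝ := Fin.append p₃ p₀ with hA₄
  set A₃ : Fin (n + n) → ℝ := Fin.append p₂ p₁ with hA₃
  set A₂ : Fin (n + n) → ℝ := Fin.append p₁ p₂ with hA₂
  set A₁ : Fin (n + n) → ℝ := Fin.append p₀ p₃ with hA₁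
  set A₀ : Fin (n + n) → ℝ := fun _ => 0 with hA₀
  set E : Fin (n + n) → ℝ := Fin.append (fun j => a j ^ 2) (fun j => (b j ^ 2)⁻¹) with hE
  have hb0 : ∀ j, 0 < b j := fun j => (h0a j).trans (hab j)
  have hA₄alg : ∀ k, IsAlgebraic ℚ (A₄ k) := isAlgebraic_append hp₃ hp₀
  have hA₃alg : ∀ k, IsAlgebraic ℚ (A₃ k) := isAlgebraic_append hp₂ hp₁
  have hA₂alg : ∀ k, IsAlgebraic ℚ (A₂ k) := isAlgebraic_append hp₁ hp₂
  have hA₁alg : ∀ k, IsAlgebraic ℚ (A₁ k) := isAlgebraic_append hp₀ hp₃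
  have hA₀alg : ∀ k, IsAlgebraic ℚ (A₀ k) := fun _ => isAlgebraic_zero
  have hEalg : ∀ k, IsAlgebraic ℚ (E k) :=
    isAlgebraic_append (fun j => (ha j).pow 2) (fun j => ((hb j).pow 2).inv)
  have hA₄0 : ∀ k, A₄ k ≠ 0 := by
    intro k; refine Fin.addCases (fun j => ?_) (fun j => ?_) k
    · rw [hA₄, Fin.append_left]; exact hp₃0 j
    · rw [hA₄, Fin.append_right]; exact hp₀0 j
  have hsep' : ∀ k, ∀ x : ℂ, (A₄ k : ℂ) * x ^ 4 + A₃ k * x ^ 3 + A₂ k * x ^ 2 + A₁ k * x + A₀ k = 0 →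
      4 * (A₄ k : ℂ) * x ^ 3 + 3 * A₃ k * x ^ 2 + 2 * A₂ k * x + A₁ k ≠ 0 := by
    intro k; refine Fin.addCases (fun j => ?_) (fun j => ?_) k
    · simp only [hA₄, hA₃, hA₂, hA₁, hA₀, Fin.append_left, Complex.ofReal_zero]
      exact sep_mulX _ _ _ _ (by exact_mod_cast hp₀0 j) (hsep j)
    · simp only [hA₄, hA₃, hA₂, hA₁, hA₀, Fin.append_right, Complex.ofReal_zero]
      exact sep_reverse _ _ _ _ (by exact_mod_cast hp₃0 j) (hsep j)
  have hroot' : ∀ k, A₄ k * E k ^ 4 + A₃ k * E k ^ 3 + A₂ k * E k ^ 2 + A₁ k * E k + A₀ k = 0 := by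
    intro k; refine Fin.addCases (fun j => ?_) (fun j => ?_) k
    · simp only [hA₄, hA₃, hA₂, hA₁, hA₀, hE, Fin.append_left]
      linear_combination (a j ^ 2) * hSa j
    · simp only [hA₄, hA₃, hA₂, hA₁, hA₀, hE, Fin.append_right]
      have hb' : b j ≠ 0 := (hb0 j).ne'
      have e : p₀ j * (b j ^ 2)⁻¹ ^ 4 + p₁ j * (b j ^ 2)⁻¹ ^ 3 + p₂ j * (b j ^ 2)⁻¹ ^ 2 + p₃ j * (b j ^ 2)⁻¹ + 0 =
          (b j ^ 2)⁻¹ ^ 4 * (p₃ j * b j ^ 6 + p₂ j * b j ^ 4 + p₁ j * b j ^ 2 + p₀ j) := by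
        field_simp
        ring
      rw [e, hSb j, mul_zero]
  have hder' : ∀ k, 0 < 4 * A₄ k * E k ^ 3 + 3 * A₃ k * E k ^ 2 + 2 * A₂ k * E k + A₁ k := by
    intro k; refine Fin.addCases (fun j => ?_) (fun j => ?_) k
    · simp only [hA₄, hA₃, hA₂, hA₁, hE, Fin.append_left]
      have e : 4 * p₃ j * (a j ^ 2) ^ 3 + 3 * p₂ j * (a j ^ 2) ^ 2 + 2 * p₁ j * a j ^ 2 + p₀ j =
          (p₃ j * a j ^ 6 + p₂ j * a j ^ 4 + p₁ j * a j ^ 2 + p₀ j) + a j ^ 2 * (3 * p₃ j * a j ^ 4 + 2 * p₂ j * a j ^ 2 + p₁ j) := by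
        ring
      rw [e, hSa j, zero_add]
      exact mul_pos (pow_pos (h0a j) 2) (hPa j)
    · simp only [hA₄, hA₃, hA₂, hA₁, hE, Fin.append_right]
      have hb2 : 0 < b j ^ 2 := pow_pos (hb0 j) 2
      have hb' : b j ≠ 0 := (hb0 j).ne'
      have e : 4 * p₀ j * (b j ^ 2)⁻¹ ^ 3 + 3 * p₁ j * (b j ^ 2)⁻¹ ^ 2 + 2 * p₂ j * (b j ^ 2)⁻¹ + p₃ j =
          (b j ^ 2)⁻¹ ^ 3 * ((3 * p₀ j + 2 * p₁ j * b j ^ 2 + p₂ j * b j ^ 4) +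
            (p₃ j * b j ^ 6 + p₂ j * b j ^ 4 + p₁ j * b j ^ 2 + p₀ j)) := by
        field_simp
        ring
      rw [e, hSb j, add_zero]
      refine mul_pos (pow_pos (inv_pos.mpr hb2) 3) ?_
      -- `3p₀ + 2p₁b² + p₂b⁴ = −b²·P′(b²)` modulo `S(b) = 0`
      have e2 : 3 * p₀ j + 2 * p₁ j * b j ^ 2 + p₂ j * b j ^ 4 =
          -(b j ^ 2 * (3 * p₃ j * b j ^ 4 + 2 * p₂ j * b j ^ 2 + p₁ j)) + 3 * (p₃ j * b j ^ 6 + p₂ j * b j ^ 4 + p₁ j * b j ^ 2 + p₀ j) := by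
        ring
      rw [e2, hSb j, mul_zero, add_zero]
      have := mul_neg_of_pos_of_neg hb2 (hPb j)
      linarith
  -- every cell of the bielliptic layer is, modulo `M₁`, a sum of cells of the quartic layer for the `2n` quartics
  have key : ∀ c : KZ.FormalRep, c ∈ AddSubgroup.closure ((fun r : KZ.IntegralRep 1 => KZ.of r) ''
      {r | r.IsRational ∨ (∃ a' b' : ℝ, IsAlgebraic ℚ a' ∧ IsAlgebraic ℚ b' ∧ a' < b' ∧ r.domain = {z | z 0 ∈ Set.Ioo a' b'} ∧
            ∃ P : Polynomial (algebraicClosure ℚ ℝ), ∀ x ∈ Set.Ioo a' b', r.integrand (fun _ => x) = Polynomial.aeval x P) ∨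
        (∃ j, ∃ c₀ c₁ : ℝ, IsAlgebraic ℚ c₀ ∧ IsAlgebraic ℚ c₁ ∧ r.domain = {z | z 0 ∈ Set.Ioo (a j) (b j)} ∧
          ∀ z ∈ r.domain, r.integrand z =
            (c₀ + c₁ * z 0) / Real.sqrt (p₃ j * (z 0) ^ 6 + p₂ j * (z 0) ^ 4 + p₁ j * (z 0) ^ 2 + p₀ j))}) →
      ∃ c' : KZ.FormalRep, c' ∈ AddSubgroup.closure ((fun r : KZ.IntegralRep 1 => KZ.of r) ''
      {r | r.IsRational ∨ (∃ a' b' : ℝ, IsAlgebraic ℚ a' ∧ IsAlgebraic ℚ b' ∧ a' < b' ∧ r.domain = {z | z 0 ∈ Set.Ioo a' b'} ∧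
            ∃ P : Polynomial (algebraicClosure ℚ ℝ), ∀ x ∈ Set.Ioo a' b', r.integrand (fun _ => x) = Polynomial.aeval x P) ∨
        (∃ k, ∃ ε₂ c₀ : ℝ, IsAlgebraic ℚ ε₂ ∧ IsAlgebraic ℚ c₀ ∧ E k < ε₂ ∧
          A₄ k * ε₂ ^ 4 + A₃ k * ε₂ ^ 3 + A₂ k * ε₂ ^ 2 + A₁ k * ε₂ + A₀ k = 0 ∧
          (∀ x ∈ Set.Ioo (E k) ε₂, 0 < A₄ k * x ^ 4 + A₃ k * x ^ 3 + A₂ k * x ^ 2 + A₁ k * x + A₀ k) ∧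
          r.domain = {z | z 0 ∈ Set.Ioo (E k) ε₂} ∧
          ∀ z ∈ r.domain, r.integrand z =
            c₀ / Real.sqrt (A₄ k * (z 0) ^ 4 + A₃ k * (z 0) ^ 3 + A₂ k * (z 0) ^ 2 + A₁ k * (z 0) + A₀ k))}) ∧
      c - c' ∈ M₁ := by
    intro c hc
    refine AddSubgroup.closure_induction (p := fun c _ => ∃ c' : KZ.FormalRep, c' ∈ _ ∧ c - c' ∈ M₁) ?_ ?_ ?_ ?_ hc
    · rintro _ ⟨r, hr, rfl⟩
      rcases hr with hrat | hpoly | ⟨j, c₀, c₁, hc₀, hc₁, hdom, hint⟩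
      · exact ⟨KZ.of r, AddSubgroup.subset_closure ⟨r, Or.inl hrat, rfl⟩, by rw [sub_self]; exact M₁.zero_mem⟩
      · exact ⟨KZ.of r, AddSubgroup.subset_closure ⟨r, Or.inr (Or.inl hpoly), rfl⟩, by rw [sub_self]; exact M₁.zero_mem⟩
      · -- the squaring move, then the reciprocal move on the cubic oval
        obtain ⟨r₁, r₂, hdom₁, hdom₂, hint₁, hint₂, hrel⟩ := stub_biellSquareCell (p₃ j) (p₂ j) (p₁ j) (p₀ j) (hp₃ j) (hp₂ j)
          (hp₁ j) (hp₀ j) (a j) (b j) c₀ c₁ (ha j) (hb j) hc₀ hc₁ (h0a j) (hab j) (hpos j) (hSa j) (hSb j) (hPa j) (hPb j) r hdom hint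
        have ha2 : 0 < a j ^ 2 := pow_pos (h0a j) 2
        have hab2 : a j ^ 2 < b j ^ 2 := by
          have := hab j; have := h0a j; nlinarith
        -- positivity of `P_j` on `(a², b²)` from that of `S_j` on `(a, b)`
        have hposP : ∀ u ∈ Set.Ioo (a j ^ 2) (b j ^ 2), 0 < p₃ j * u ^ 3 + p₂ j * u ^ 2 + p₁ j * u + p₀ j := by
          intro u hu
          have hu0 : 0 < u := ha2.trans hu.1
          have hx : Real.sqrt u ∈ Set.Ioo (a j) (b j) := by
            constructor
            · calc a j = Real.sqrt (a j ^ 2) := (Real.sqrt_sq (h0a j).le).symm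
                _ < Real.sqrt u := Real.sqrt_lt_sqrt (sq_nonneg _) hu.1
            · calc Real.sqrt u < Real.sqrt (b j ^ 2) := Real.sqrt_lt_sqrt hu0.le hu.2
                _ = b j := Real.sqrt_sq (hb0 j).le
          have h := hpos j (Real.sqrt u) hx
          have hsq : Real.sqrt u ^ 2 = u := Real.sq_sqrt hu0.le
          have e : p₃ j * Real.sqrt u ^ 6 + p₂ j * Real.sqrt u ^ 4 + p₁ j * Real.sqrt u ^ 2 + p₀ j =
              p₃ j * u ^ 3 + p₂ j * u ^ 2 + p₁ j * u + p₀ j := by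
            rw [show Real.sqrt u ^ 6 = (Real.sqrt u ^ 2) ^ 3 by ring, show Real.sqrt u ^ 4 = (Real.sqrt u ^ 2) ^ 2 by ring, hsq]
          rw [e] at h
          exact h
        obtain ⟨r₂', hdom₂', hint₂', hrel₂⟩ := stub_cubicOvalReciprocalCell (p₃ j) (p₂ j) (p₁ j) (p₀ j) (hp₃ j) (hp₂ j)
          (hp₁ j) (hp₀ j) (a j ^ 2) (b j ^ 2) (c₁ / 2) ((ha j).pow 2) ((hb j).pow 2) (hc₁.mul (isAlgebraic_nat 2).inv)
          ha2 hab2 hposP r₂ hdom₂ hint₂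
        refine ⟨KZ.of r₁ + KZ.of r₂', AddSubgroup.add_mem _ ?_ ?_, ?_⟩
        · -- `r₁` is an oval cell of the quartic `u·P_j(u)` marked at `a_j²`
          refine AddSubgroup.subset_closure ⟨r₁, Or.inr (Or.inr ⟨Fin.castAdd n j, b j ^ 2, c₀ / 2, (hb j).pow 2,
            hc₀.mul (isAlgebraic_nat 2).inv, ?_, ?_, ?_, ?_, ?_⟩), rfl⟩
          · simp only [hE, Fin.append_left]; exact hab2
          · simp only [hA₄, hA₃, hA₂, hA₁, hA₀, Fin.append_left]
            linear_combination (b j ^ 2) * hSb j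
          · intro x hx
            simp only [hE, Fin.append_left] at hx
            simp only [hA₄, hA₃, hA₂, hA₁, hA₀, Fin.append_left, add_zero]
            have hx0 : 0 < x := ha2.trans hx.1
            have e : p₃ j * x ^ 4 + p₂ j * x ^ 3 + p₁ j * x ^ 2 + p₀ j * x = x * (p₃ j * x ^ 3 + p₂ j * x ^ 2 + p₁ j * x + p₀ j) := by
              ring
            rw [e]
            exact mul_pos hx0 (hposP x hx)
          · simp only [hE, Fin.append_left]; exact hdom₁
          · intro z hz
            simp only [hA₄, hA₃, hA₂, hA₁, hA₀, Fin.append_left, add_zero]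
            exact hint₁ z hz
        · -- `r₂'` is an oval cell of the quartic `v·P_j*(v)` marked at `1/b_j²`
          refine AddSubgroup.subset_closure ⟨r₂', Or.inr (Or.inr ⟨Fin.natAdd n j, (a j ^ 2)⁻¹, c₁ / 2, ((ha j).pow 2).inv,
            hc₁.mul (isAlgebraic_nat 2).inv, ?_, ?_, ?_, ?_, ?_⟩), rfl⟩
          · simp only [hE, Fin.append_right]
            exact (inv_lt_inv₀ (ha2.trans hab2) ha2).mpr hab2
          · simp only [hA₄, hA₃, hA₂, hA₁, hA₀, Fin.append_right]
            have ha' : a j ≠ 0 := (h0a j).ne'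
            have e : p₀ j * (a j ^ 2)⁻¹ ^ 4 + p₁ j * (a j ^ 2)⁻¹ ^ 3 + p₂ j * (a j ^ 2)⁻¹ ^ 2 + p₃ j * (a j ^ 2)⁻¹ + 0 =
                (a j ^ 2)⁻¹ ^ 4 * (p₃ j * a j ^ 6 + p₂ j * a j ^ 4 + p₁ j * a j ^ 2 + p₀ j) := by
              field_simp
              ring
            rw [e, hSa j, mul_zero]
          · intro x hx
            simp only [hE, Fin.append_right] at hx
            simp only [hA₄, hA₃, hA₂, hA₁, hA₀, Fin.append_right, add_zero]
            have hb2 : 0 < b j ^ 2 := pow_pos (hb0 j) 2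
            have hx0 : 0 < x := (inv_pos.mpr hb2).trans hx.1
            have hxinv : x⁻¹ ∈ Set.Ioo (a j ^ 2) (b j ^ 2) :=
              ⟨(lt_inv_comm₀ ha2 hx0).mpr hx.2, (inv_lt_comm₀ hx0 hb2).mpr hx.1⟩
            have h := hposP x⁻¹ hxinv
            have hx' : x ≠ 0 := hx0.ne'
            have e : p₀ j * x ^ 4 + p₁ j * x ^ 3 + p₂ j * x ^ 2 + p₃ j * x =
                x ^ 4 * (p₃ j * x⁻¹ ^ 3 + p₂ j * x⁻¹ ^ 2 + p₁ j * x⁻¹ + p₀ j) := by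
              field_simp
              ring
            rw [e]
            exact mul_pos (pow_pos hx0 4) h
          · simp only [hE, Fin.append_right]; exact hdom₂'
          · intro z hz
            simp only [hA₄, hA₃, hA₂, hA₁, hA₀, Fin.append_right, add_zero]
            exact hint₂' z hz
        · -- `[r] − [r₁] − [r₂′] = ([r] − [r₁] − [r₂]) + ([r₂] − [r₂′]) ∈ M₁`
          have e : KZ.of r - (KZ.of r₁ + KZ.of r₂') = (KZ.of r - KZ.of r₁ - KZ.of r₂) + (KZ.of r₂ - KZ.of r₂') := by abel
          rw [e]
          exact M₁.add_mem (closure_rules_le_M₁ hrel) (HomotopyInvariance.changeOfVariablesRel_subset hrel₂)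
    · exact ⟨0, AddSubgroup.zero_mem _, by rw [sub_self]; exact M₁.zero_mem⟩
    · rintro c₁ c₂ _ _ ⟨c₁', h₁', h₁⟩ ⟨c₂', h₂', h₂⟩
      refine ⟨c₁' + c₂', AddSubgroup.add_mem _ h₁' h₂', ?_⟩
      have e : c₁ + c₂ - (c₁' + c₂') = (c₁ - c₁') + (c₂ - c₂') := by abel
      rw [e]
      exact M₁.add_mem h₁ h₂
    · rintro c₁ _ ⟨c₁', h₁', h₁⟩
      refine ⟨-c₁', AddSubgroup.neg_mem _ h₁', ?_⟩
      have e : -c₁ - -c₁' = -(c₁ - c₁') := by abel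
      rw [e]
      exact M₁.neg_mem h₁
  obtain ⟨c', hc', hcc'⟩ := key c hc
  have heval' : KZ.eval c' = 0 := by
    have h := Summit.KontsevichZagierPeriods.SymplecticScissors.RealOnePeriodRelationsNegative.eval_eq_zero_of_mem_M₁ hcc'
    rw [map_sub, heval, zero_sub, neg_eq_zero] at h
    exact h
  have hM : c' ∈ M₁ :=
    QuarticLayer.realOnePeriodRelations_ratQuarticOvalLayer (n + n) A₄ A₃ A₂ A₁ A₀ E hA₄alg hA₃alg hA₂alg hA₁alg hA₀alg hEalg
      hA₄0 hsep' hroot' hder' c' hc' heval'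
  have e : c = (c - c') + c' := by abel
  rw [e]
  exact M₁.add_mem hcc' hM

end BiellipticLayer

end Summit.KontsevichZagierPeriods.SymplecticScissors.RealOnePeriodRelations

end
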